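import Summits.Ventures.YMGap.FlowData.TubeFluxEnergyWindow
import Summits.Ventures.LatticeQCDFlow.Scoring.OnePlaquetteBessel
import Literature.Analysis.FunctionSpaces.BesselIIntegralSeries
import HarnessLib

/-!
# Venture YMGap, track Y3 FLOW-DATA — the strong-coupling ANCHORS of the flux-energy ratios:
# `E₁ → ∞` and `E_e / E₁ → |e|` as `β → 0⁺` on every finite tube (theorems only)

HONEST FRAMING: venture file of the cell `pub-ymgap` (QuantumFields programme), track Y3; corollaries of the
strong-coupling windows (`TubeStrongCouplingWindow`, `TubeFluxEnergyWindow`) for the typed objects of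
`FlowData/TorelonEnergy.lean`.  Finite tubes only; no number of the FLOW-TABLE, no row, nothing about `L → ∞`, the
continuum or a mass gap.  The FLOW-TABLE's ratio rows (`R2 = E₂/E₁`, …) measure the crossover AWAY from these
anchors; the anchors themselves are theorems.

* `su2CharacterRatio_le_div_four` — `u(β) ≤ β/4` for `β > 0` (Amos' bound `I₂/I₁ ≤ β/(1+√(β²+9))` of the tree);
* `tendsto_neg_log_su2CharacterRatio_atTop` — `−ln u(β) → +∞` as `β → 0⁺`;
* **`tendsto_su2TorelonEnergy_atTop`** — `E₁(β) → +∞` as `β → 0⁺` on every tube with `k ≥ 1`... stated for every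
  axis `μ : Fin k` (so `k ≥ 1` automatically);
* **`tendsto_su2FluxEnergy_div_su2TorelonEnergy`** — `E_e(β)/E₁(β) → |e|` as `β → 0⁺` for every flux `e` and every
  axis: `E₂/E₁ → 2`, `E₃/E₁ → 3` on every finite tube.

References: D. E. Amos, Math. Comp. 28 (1974) 239 [cite: Amos1974, (11)]; I. Montvay, G. Münster (1994) §3.2.6
[cite: MontvayMunster1994, §3.2.6].
-/

noncomputable section

open scoped Topology
open MeasureTheory Filter Function Set
open Literature.MathematicalPhysics.QuantumFieldTheory Literature.MathematicalPhysics.QuantumLattice Literature.Analysis.FunctionSpaces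
open Summit.Ventures.LatticeQCDFlow.Exactness Summit.Ventures.LatticeQCDFlow.Scoring
open Summit.Ventures.YMGap.Conjectures (su2CharacterRatio su2CharacterRatio_pos)

namespace Summit.Ventures.YMGap.FlowData

section Anchors

/-- **`u(β) ≤ β/4`** for `β > 0` (`u = I₂/I₁ ≤ β/(1 + √(β² + 9)) ≤ β/4`). [cite: Amos1974, (11)] -/
theorem su2CharacterRatio_le_div_four {β : ℝ} (hβ : 0 < β) : su2CharacterRatio β ≤ β / 4 := by
  have h1 : su2CharacterRatio β = besselI 2 β / besselI 1 β := onePlaquetteExpectSU2_cos_eq_besselI_div β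
  have h2 := Literature.Probability.LatticeModels.besselI_succ_div_besselI_le_div hβ 1
  rw [h1, besselI_eq_latticeModels_besselI 2 β, besselI_eq_latticeModels_besselI 1 β]
  have h3 : ((1 + 1 : ℕ) : ℤ) = ((2 : ℕ) : ℤ) := by norm_num
  rw [h3] at h2
  refine h2.trans ?_
  have hsq : (3 : ℝ) ≤ Real.sqrt (β ^ 2 + ((1 : ℕ) + 2) ^ 2) := by
    rw [show ((1 : ℕ) : ℝ) + 2 = 3 by norm_num]
    calc (3 : ℝ) = Real.sqrt (3 ^ 2) := by rw [Real.sqrt_sq (by norm_num)]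
      _ ≤ Real.sqrt (β ^ 2 + 3 ^ 2) := Real.sqrt_le_sqrt (by nlinarith)
  have hden : (4 : ℝ) ≤ (1 : ℕ) + Real.sqrt (β ^ 2 + ((1 : ℕ) + 2) ^ 2) := by
    push_cast at hsq ⊢; linarith
  exact div_le_div_of_nonneg_left hβ.le (by norm_num) hden

/-- **`−ln u(β) → +∞` as `β → 0⁺`.** [folklore] -/
theorem tendsto_neg_log_su2CharacterRatio_atTop :
    Tendsto (fun β : ℝ => -Real.log (su2CharacterRatio β)) (𝓝[>] (0 : ℝ)) atTop := by
  have h1 : Tendsto (fun β : ℝ => -Real.log (β / 4)) (𝓝[>] (0 : ℝ)) atTop := by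
    have h : Tendsto (fun β : ℝ => β / 4) (𝓝[>] (0 : ℝ)) (𝓝[>] (0 : ℝ)) := by
      refine tendsto_nhdsWithin_of_tendsto_nhds_of_eventually_within _ ?_ ?_
      · have : Tendsto (fun β : ℝ => β / 4) (𝓝 (0 : ℝ)) (𝓝 (0 / 4)) := (continuous_id.div_const 4).tendsto 0
        rw [zero_div] at this
        exact this.mono_left nhdsWithin_le_nhds
      · filter_upwards [self_mem_nhdsWithin] with β hβ
        exact div_pos (Set.mem_Ioi.1 hβ) (by norm_num)
    exact tendsto_neg_atBot_atTop.comp (Real.tendsto_log_nhdsGT_zero.comp h)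
  refine tendsto_atTop_mono' _ ?_ h1
  filter_upwards [self_mem_nhdsWithin] with β hβ
  exact neg_le_neg (Real.log_le_log (su2CharacterRatio_pos (Set.mem_Ioi.1 hβ))
    (su2CharacterRatio_le_div_four (Set.mem_Ioi.1 hβ)))

variable {k : ℕ}

/-- **`E₁(β) → +∞` as `β → 0⁺`** on every tube `(ℤ/L)^k` and every axis (the window's lower half and
`−ln u → ∞`). [cite: MontvayMunster1994, §3.2.6] -/
theorem tendsto_su2TorelonEnergy_atTop (L : ℕ) [NeZero L] (μ : Fin k) :
    Tendsto (fun β : ℝ => su2TorelonEnergy β k L μ) (𝓝[>] (0 : ℝ)) atTop := by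
  have hL : (1 : ℝ) ≤ L := by exact_mod_cast Nat.one_le_iff_ne_zero.2 (NeZero.ne L)
  -- `E₁ ≥ (−ln u) − 2·#P` for `0 < β ≤ 1`
  have hev : ∀ᶠ β in 𝓝[>] (0 : ℝ), -Real.log (su2CharacterRatio β) - 2 * Fintype.card (Plaquette k L) ≤
      su2TorelonEnergy β k L μ := by
    have hmem : Set.Ioo (0 : ℝ) 1 ∈ 𝓝[>] (0 : ℝ) := Ioo_mem_nhdsGT (by norm_num)
    filter_upwards [hmem] with β hβ
    have h := su2TorelonEnergy_ge_window hβ.1 k L μ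
    have hu1 : su2CharacterRatio β ≤ 1 := (su2CharacterRatio_le_div_four hβ.1).trans (by linarith [hβ.2])
    have hlog : 0 ≤ -Real.log (su2CharacterRatio β) :=
      neg_nonneg.2 (Real.log_nonpos (su2CharacterRatio_pos hβ.1).le hu1)
    have hP : 0 ≤ (Fintype.card (Plaquette k L) : ℝ) := Nat.cast_nonneg _
    have h1 : -Real.log (su2CharacterRatio β) ≤ (L : ℝ) * -Real.log (su2CharacterRatio β) := by
      nlinarith
    have h2 : 2 * β * (Fintype.card (Plaquette k L) : ℝ) ≤ 2 * Fintype.card (Plaquette k L) := by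
      nlinarith [hβ.2]
    linarith
  refine tendsto_atTop_mono' _ hev ?_
  exact tendsto_atTop_add_const_right _ _ tendsto_neg_log_su2CharacterRatio_atTop

/-- **THE STRONG-COUPLING ANCHOR OF THE FLUX-ENERGY RATIOS**: `E_e(β)/E₁(β) → |e|` as `β → 0⁺`, for every flux
`e ∈ ℤ₂^k`, every axis `μ`, on every tube `(ℤ/L)^k` (`E₂/E₁ → 2`, `E₃/E₁ → 3`).  The numerator and denominator
sit within `2β·#P` of `|e|·L·(−ln u)` and `L·(−ln u)`, and `E₁ → ∞`. [cite: MontvayMunster1994, §3.2.6] -/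
theorem tendsto_su2FluxEnergy_div_su2TorelonEnergy (L : ℕ) [NeZero L] (e : Fin k → ZMod 2) (μ : Fin k) :
    Tendsto (fun β : ℝ => su2FluxEnergy β k L e / su2TorelonEnergy β k L μ) (𝓝[>] (0 : ℝ))
      (𝓝 ((Finset.univ.filter fun ν => e ν = 1).card : ℝ)) := by
  set r : ℝ := ((Finset.univ.filter fun ν => e ν = 1).card : ℝ) with hr
  set P : ℝ := (Fintype.card (Plaquette k L) : ℝ) with hP
  have hr0 : 0 ≤ r := Nat.cast_nonneg _
  have hE := tendsto_su2TorelonEnergy_atTop (k := k) L μ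
  -- the numerator of `E_e/E₁ − r = (E_e − r E₁)/E₁` is bounded for `0 < β ≤ 1`
  have hbd : ∀ᶠ β in 𝓝[>] (0 : ℝ), |su2FluxEnergy β k L e - r * su2TorelonEnergy β k L μ| ≤ 2 * P * (1 + r) := by
    have hmem : Set.Ioo (0 : ℝ) 1 ∈ 𝓝[>] (0 : ℝ) := Ioo_mem_nhdsGT (by norm_num)
    filter_upwards [hmem] with β hβ
    have h1 := abs_su2FluxEnergy_sub_le hβ.1 k L e
    have h2 := abs_su2TorelonEnergy_sub_le hβ.1 k L μ
    set a : ℝ := (L : ℝ) * (-Real.log (su2CharacterRatio β)) with ha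
    have h3 : |su2FluxEnergy β k L e - r * su2TorelonEnergy β k L μ| ≤
        |su2FluxEnergy β k L e - r * a| + r * |a - su2TorelonEnergy β k L μ| := by
      have : su2FluxEnergy β k L e - r * su2TorelonEnergy β k L μ =
          (su2FluxEnergy β k L e - r * a) + r * (a - su2TorelonEnergy β k L μ) := by ring
      rw [this]
      refine (abs_add_le _ _).trans ?_
      rw [abs_mul, abs_of_nonneg hr0]
    have hP0 : 0 ≤ P := Nat.cast_nonneg _
    have hβP : 2 * β * (Fintype.card (Plaquette k L) : ℝ) ≤ 2 * P := by rw [hP]; nlinarith [hβ.2]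
    have h1' : |su2FluxEnergy β k L e - r * a| ≤ 2 * P := by
      have : r * a = r * L * (-Real.log (su2CharacterRatio β)) := by rw [ha]; ring
      rw [this]
      exact h1.trans hβP
    have h2' : |a - su2TorelonEnergy β k L μ| ≤ 2 * P := by
      rw [abs_sub_comm]
      exact h2.trans hβP
    calc |su2FluxEnergy β k L e - r * su2TorelonEnergy β k L μ|
        ≤ |su2FluxEnergy β k L e - r * a| + r * |a - su2TorelonEnergy β k L μ| := h3
      _ ≤ 2 * P + r * (2 * P) := add_le_add h1' (mul_le_mul_of_nonneg_left h2' hr0)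
      _ = 2 * P * (1 + r) := by ring
  -- `(E_e − r E₁)/E₁ → 0`
  have hinv : Tendsto (fun β : ℝ => (su2TorelonEnergy β k L μ)⁻¹) (𝓝[>] (0 : ℝ)) (𝓝 0) := hE.inv_tendsto_atTop
  have hquot : Tendsto (fun β : ℝ => (su2FluxEnergy β k L e - r * su2TorelonEnergy β k L μ) /
      su2TorelonEnergy β k L μ) (𝓝[>] (0 : ℝ)) (𝓝 0) := by
    have hb : Tendsto (fun β : ℝ => 2 * P * (1 + r) * |(su2TorelonEnergy β k L μ)⁻¹|) (𝓝[>] (0 : ℝ)) (𝓝 0) := by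
      have := (hinv.abs).const_mul (2 * P * (1 + r))
      rw [abs_zero, mul_zero] at this
      exact this
    refine squeeze_zero_norm' ?_ hb
    filter_upwards [hbd] with β hβ
    rw [Real.norm_eq_abs, div_eq_mul_inv, abs_mul]
    exact mul_le_mul_of_nonneg_right hβ (abs_nonneg _)
  -- assemble: `E_e/E₁ = r + (E_e − r E₁)/E₁` eventually
  have hpos : ∀ᶠ β in 𝓝[>] (0 : ℝ), 0 < su2TorelonEnergy β k L μ := hE.eventually_gt_atTop 0
  have heq : ∀ᶠ β in 𝓝[>] (0 : ℝ), su2FluxEnergy β k L e / su2TorelonEnergy β k L μ =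
      r + (su2FluxEnergy β k L e - r * su2TorelonEnergy β k L μ) / su2TorelonEnergy β k L μ := by
    filter_upwards [hpos] with β hβ
    field_simp
    ring
  have hlim : Tendsto (fun β : ℝ => r + (su2FluxEnergy β k L e - r * su2TorelonEnergy β k L μ) /
      su2TorelonEnergy β k L μ) (𝓝[>] (0 : ℝ)) (𝓝 (r + 0)) := tendsto_const_nhds.add hquot
  rw [add_zero] at hlim
  exact hlim.congr' (EventuallyEq.symm heq)

end Anchors

end Summit.Ventures.YMGap.FlowData
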